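import Mathlib
import HarnessLib
import Summits.QuantumAdvantage.QuantumAdvantage.Theses.SosSandwich
import Literature.Computability.QuantumComplexity.AaronsonAmbainisThm23Queries
import Literature.Computability.QuantumComplexity.PseudoBounded

/-!
# Route `SosSandwich`, crux `TransferPB` (stmt-QuantumAdvantage-15238): registered stub statements of the line `birth`

`Defs` file (D-0016 `<Route>Defs` convention; precedent
`Summits/AnomalousDissipation/AnomalousDissipation/Theorems/DecimationAxisUniformEquilibrationDefs.lean`) of
the crux skeleton `Summits/QuantumAdvantage/QuantumAdvantage/Cruxes/TransferPB/Lines/birth.lean`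
(sha da18b1e6f9e760f8…, registrar planner-skel-stmt-QuantumAdvantage-15238-0, three registered stubs
`stub_oracleAcceptPseudoBounded`, `stub_pbOracleSimulation`, `stub_promiseOracleElimination`, each
registered with the signature `Sig.stub_<name>`). A `Cruxes/…/Lines/*.lean` skeleton is not an importable
module, so the STATEMENTS of its registered stubs live here — copied VERBATIM from the skeleton (same
namespace `Summit.QuantumAdvantage.QuantumAdvantage.Cruxes.TransferPB.Birth`, same names) — to be imported
by the stub files `Theorems/SosSandwichTransferPBStub<Name>.lean` (landed `--supports stmt-QuantumAdvantage-15238`)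
and by the closing composition; the skeleton is re-pointed by importing this module and deleting its local
copies (zero renaming).

Nothing open is asserted: every `def … : Prop` is a statement (a registered stub signature, or the
conclusion `OracleSimulation` shared by stub 2 and the glue), consumed only as the type of a stub theorem or
as an explicit hypothesis. No theorem is proved here.

Contents (verbatim from the skeleton):
* `Sig.stub_oracleAcceptPseudoBounded` — oracle acceptance polynomials are pseudo-bounded of order
  `#oracle gates` (Beals–Buhrman–Cleve–Mosca–de Wolf Lemma 4.1 for oracle circuits + unitarity);
* `OracleSimulation` — the conclusion of stub 2 (Aaronson–Ambainis Thm 23 relative to a promise-`BQP`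
  oracle: one deterministic polynomial-time transcript machine with the combined oracle `A ⊕ g`);
* `Sig.stub_pbOracleSimulation := Sig.stub_oracleAcceptPseudoBounded → PseudoBoundedAA → OracleSimulation`;
* `Sig.stub_promiseOracleElimination` — promise-`BPP'` oracle elimination relative to a random oracle
  (verbatim piece 2 `PromiseOracleElimination` of the sibling split of `PromiseTransfer`,
  `Cruxes/PromiseTransfer/SPLIT-CHILDREN.md`).

Deliberately NOT here: any proof of a stub (separate files, one per stub), the sorried `stub_*` placeholders,
the glue `ae_BQPRel_subset_AvgPRel_of_simulation` / `TransferPB_of` / `TransferPB_proof` of the skeleton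
(they stay under `Cruxes/` until the last stub closes).
Sources: arXiv:0911.0996 (Aaronson–Ambainis 2014, Lemma 20, Thm 21, Thm 23); arXiv:quant-ph/9802049
(Beals et al., Lemma 4.1); arXiv:1411.7280 (Kaniewski–Lee–de Wolf, Thm 12); BennettGill1981 (Thm 5).
-/

-- D-0017: single-conjunct summit ⇒ the duplicate `QuantumAdvantage.QuantumAdvantage` is mandated.
set_option linter.dupNamespace false

noncomputable section

namespace Summit.QuantumAdvantage.QuantumAdvantage.Cruxes.TransferPB.Birth

open MeasureTheory Literature.Computability.Complexity Literature.Computability.Cryptography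
  Literature.Computability.QuantumComplexity
open Summit.QuantumAdvantage.QuantumAdvantage.Theses.SosSandwich
open scoped ENNReal

/-- **Stub 1 statement — oracle acceptance polynomials are pseudo-bounded (`Q_T ⊆ K_T` for oracle circuits).**
For every Clifford+T oracle circuit family `F` and input `x`, the tree's acceptance polynomial `acceptPoly F x`
(`AaronsonAmbainisThm23Queries.lean`: a real polynomial in the `numOracleBits F x` relevant oracle bits with
`evalBool (acceptPoly F x) (oracleBits F x A) = F.acceptProbOn A x`) is pseudo-bounded of order
`(F.circ |x|).oracleQueries` (tree `PseudoBounded`: `p` and `1 − p` are sums of squares of polynomials of total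
degree `≤ #oracle gates`, as functions on the cube). Verbatim the registered signature of
`stub_oracleAcceptPseudoBounded` (skeleton `Cruxes/TransferPB/Lines/birth.lean`); the statement proved by Beals et al.'s
Lemma 4.1 plus unitarity (Kaniewski–Lee–de Wolf Thm. 12, `Q_T ⊆ K_T`). A registered stub SIGNATURE of this
route's crux, not a literature fact. -/
def Sig.stub_oracleAcceptPseudoBounded : Prop :=
  ∀ (F : QCircuitFamily cliffordT) (x : List Bool),
    PseudoBounded (F.circ x.length).oracleQueries (acceptPoly F x)

/-- The conclusion of stub 2: Aaronson–Ambainis' average-case simulation of every uniform oracle family by ONE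
deterministic polynomial-time transcript machine with the COMBINED oracle `A ⊕ g`
(`false :: v ↦ [v ∈ A]`, `true :: v ↦ g v`), for every answer function `g` correct on the promise of a fixed
`Q ∈ PromiseBQP` — VERBATIM the conclusion of the sibling piece `PromiseOracleSimulation`
(`Cruxes/PromiseTransfer/Lines/promise_oracle_split.lean`) and of the skeleton's `OracleSimulation` (the shape of
Aaronson–Ambainis 2014 Thm. 23 relative to a promise oracle). A statement consumed as a hypothesis, not a literature fact. -/
def OracleSimulation : Prop :=
  ∀ F : QCircuitFamily cliffordT, F.IsUniform → ∀ r : Polynomial ℕ,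
    ∃ Q ∈ Literature.Computability.Cryptography.PromiseBQP, ∃ (C : OracleAlg Bool) (q : Polynomial ℕ),
      C.IsPolyTime Computability.encodingBoolBool ∧
      (∀ (O : Oracle) (x : List Bool), ∀ y ∈ C.queries O (q.eval x.length) x, y.length ≤ q.eval x.length) ∧
      ∀ x : List Bool, 1 ≤ x.length → ∀ g : List Bool → Bool,
        (∀ v ∈ Q.yes, g v = true) → (∀ v ∈ Q.no, g v = false) →
        (ProbabilityTheory.setBernoulli (Set.univ : Set (List Bool)) ⟨1 / 2, by norm_num, by norm_num⟩)
          {A : Set (List Bool) |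
            (2 / 3 ≤ F.acceptProbOn A x ∧
              C.run (Oracle.ofLanguage {w : List Bool | ∃ v : List Bool, (w = false :: v ∧ v ∈ A) ∨ (w = true :: v ∧ g v = true)}) (q.eval x.length) x ≠ some true) ∨
            (F.acceptProbOn A x ≤ 1 / 3 ∧
              C.run (Oracle.ofLanguage {w : List Bool | ∃ v : List Bool, (w = false :: v ∧ v ∈ A) ∨ (w = true :: v ∧ g v = true)}) (q.eval x.length) x ≠ some false)}
          ≤ ENNReal.ofReal (1 / (((r.eval x.length : ℕ) : ℝ) + 1))

/-- **Stub 2 statement — Aaronson–Ambainis Thm 23 relative to a promise-BQP oracle, UNDER PB-AA.** Granted the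
pseudo-boundedness of oracle acceptance polynomials (stub 1) and the route's `PseudoBoundedAA` (the crux's own
antecedent, by name), the average-case simulation `OracleSimulation` holds. Verbatim the registered signature of
`stub_pbOracleSimulation` (Aaronson–Ambainis 2014 Thm. 21/23 under PB-AA). A registered stub SIGNATURE, not a literature fact. -/
def Sig.stub_pbOracleSimulation : Prop :=
  Sig.stub_oracleAcceptPseudoBounded → PseudoBoundedAA → OracleSimulation

/-- **Stub 3 statement — PROMISE-BPP' ORACLE ELIMINATION relative to a random oracle** (Bennett–Gill coins read
off far oracle positions, majority amplification, union bound over the short promise instances); VERBATIM piece 2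
`PromiseOracleElimination` of the sibling split of `PromiseTransfer` and the registered signature of
`stub_promiseOracleElimination` (Bennett–Gill's coins-from-the-oracle mechanism). A registered stub SIGNATURE, not a literature fact. -/
def Sig.stub_promiseOracleElimination : Prop :=
  ∀ Q ∈ Literature.Computability.Complexity.PromiseBPP', ∀ (C : OracleAlg Bool) (q : Polynomial ℕ),
    C.IsPolyTime Computability.encodingBoolBool →
    (∀ (O : Oracle) (x : List Bool), ∀ y ∈ C.queries O (q.eval x.length) x, y.length ≤ q.eval x.length) →
    ∀ ℓ r : Polynomial ℕ, ∃ (C' : OracleAlg Bool) (q' : Polynomial ℕ),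
      C'.IsPolyTime Computability.encodingBoolBool ∧
      (∀ (A : Language Bool) (x : List Bool), ∀ y ∈ C'.queries (Oracle.ofLanguage A) (q'.eval x.length) x, y.length ≤ q'.eval x.length) ∧
      ∀ x : List Bool, 1 ≤ x.length →
        ∃ (V : Finset (List Bool)) (ĝ : Set (List Bool) → (List Bool → Bool)),
          (∀ v ∈ V, ℓ.eval x.length < v.length) ∧
          (∀ A : Set (List Bool), ĝ A = ĝ (A ∩ ↑V)) ∧
          (∀ (A : Set (List Bool)) (b : Bool),
            C.run (Oracle.ofLanguage {w : List Bool | ∃ v : List Bool, (w = false :: v ∧ v ∈ A) ∨ (w = true :: v ∧ ĝ A v = true)}) (q.eval x.length) x = some b →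
            C'.run (Oracle.ofLanguage A) (q'.eval x.length) x = some b) ∧
          (ProbabilityTheory.setBernoulli (Set.univ : Set (List Bool)) ⟨1 / 2, by norm_num, by norm_num⟩)
            {A : Set (List Bool) | ¬ ((∀ v ∈ Q.yes, ĝ A v = true) ∧ (∀ v ∈ Q.no, ĝ A v = false))}
            ≤ ENNReal.ofReal (1 / (((r.eval x.length : ℕ) : ℝ) + 1))

end Summit.QuantumAdvantage.QuantumAdvantage.Cruxes.TransferPB.Birth

end
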